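import Summits.BirchSwinnertonDyer.BirchSwinnertonDyer.Theorems.PrintX10bBeyondCarrierUpperLinkCoprimePinned
import Summits.BirchSwinnertonDyer.BirchSwinnertonDyer.Theorems.PrintX9HowardContainmentLightFrameOfPrintDepthPosLocalized
import Literature.NumberTheory.EllipticCurves.IwasawaAlgebraPromotionProofs
import HarnessLib

/-!
# Crux `BeyondCarrierDepthX10b` (stmt-BirchSwinnertonDyer-23055, PrintX10b aside r301 since rev 20), line «twins»,
# skeleton v6.2: the guarded stubs s2b/s2c BY SIGNATURE — and the μ-part REDUCED TO THE μ-INEQUALITY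

HONEST FRAMING (cell `run/shared/lean/pub/bsd-print-x9/`, LEAD seat bsd-line-x10b-p1 g2, D-0154 KEY row 10): THEOREMS
ONLY, helpers `--supports 23055`; nothing booked, nothing closed. «beyond-print theorem»: NO. BSD is not proved by any
of this; no summit statement is proved by this seat.

WHY v6.2. In v6.1 the μ-part stub s2c could only be reduced to `μ(X_tors) = 0` (`…_of_muInvariant_eq_zero`, p614983):
its ∃-hypothesis did not carry `𝔖` f.g. and `𝔖/ℋ_F` torsion, without which `I(ℋ_F) = char_Λ(𝔖/ℋ_F)` has junk value
`⊤` and the sharp promotion (p613811) cannot fire. v6.2 threads both guards through the cut — s2b outputs `𝔖` f.g.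
(CGLS Thm. 4.1.3 conclusion (i)), s2a outputs the torsion (26359's letter), s2c's hypothesis carries them — so that the
research stub s2c is implied by the μ-INEQUALITY `μ(X_tors) ≤ 2·μ(𝔖/ℋ_F)` for the tied family (this file), the
HPMC-implied residual; `μ(X_tors) = 0` remains a (strictly stronger) sufficient condition. TEMPLATE for the deciding
twins 26623 (X10b) / 26359 (X9): add the same two guards to `stub_muPartTied`'s ∃-hypothesis (both are in hand in
their compositions: `hCGLS` conjunct (i) and `s_env`'s torsion clause) and `stub_muPartTied ⟸ μ-inequality` is the
one-liner below.

WHAT.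
* `stub_localizedStabilized_divisibleClassNumber_of_cgls' (hCGLS)` — v6.2 stub s2b VERBATIM modulo the cite-only CGLS
  fact: `𝔖` f.g. ∧ `X.X` f.g. ∧ `∃ m, (p^m)·I(Λκ_∞(C))² ⊆ char_Λ(X_tors)` on the rank-one `3 ∣ h_K` X10b frames.
* `stub_muPart_divisibleClassNumber_of_muInvariant_le (hμle)` — v6.2 stub s2c VERBATIM from the μ-INEQUALITY: on every
  rank-one `3 ∣ h_K` X10b frame, for every `(D, F, X)` with `F.Dt = Dt`, `𝔖`, `X.X` f.g. and `𝔖/ℋ_F` torsion,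
  `length (X_tors)_(p) ≤ 2 · length (𝔖/ℋ_F)_(p)`. Proof: `IwasawaAlgebra.sq_charIdeal_le_charIdeal_of_span_p_pow_mul_le_of_lengthAt_le_two_mul`
  (p613811) at `X := X_tors`, `Y := 𝔖/ℋ_F` (`heegnerCharIdeal D F` is `char_Λ(𝔖/ℋ_F)` by definition).

References: [CastellaGrossiLeeSkinner2022] Thm. 4.1.3, Cor. 3.4.2; [Washington1997] §13.2; [Howard2004HeegnerKolyvagin]
Thm. B; [MastellaZerman2026] Cor. 4.6; [PerrinRiou1987BSMF] §1 Conj. B; skeleton v6.2 `Cruxes/BeyondCarrierDepthX10b/Lines/twins.lean`.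
-/

-- the REGISTERED stub namespace `Summit.BirchSwinnertonDyer.BirchSwinnertonDyer.Cruxes.…` repeats the summit name
set_option linter.dupNamespace false
set_option autoImplicit false

noncomputable section

open scoped Classical

open WeierstrassCurve NumberField IsDedekindDomain Field Literature.NumberTheory.EllipticCurves
  Literature.NumberTheory.EllipticCurves.ModularForms Literature.NumberTheory.EllipticCurves.Rank1Residual
  Literature.NumberTheory.EllipticCurves.Castella2018 Literature.NumberTheory.EllipticCurves.YanZhu2026
  Literature.NumberTheory.EllipticCurves.CastellaGrossiLeeSkinner2022
  Literature.NumberTheory.EllipticCurves.JetchevSkinnerWan2017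

open Summit.BirchSwinnertonDyer.Rank1Residual
open Summit.BirchSwinnertonDyer.BirchSwinnertonDyer.Rank1Residual (X10.thm413Hypotheses_of_classX10)
open Summit.BirchSwinnertonDyer.BirchSwinnertonDyer.Cruxes.TwoSidedLinkAnyClassNumberX10b.CompositeTransferX10b
  (imcWaldspurgerOnTreeGoodAt_inducedPlace_of_printFacts_of_pinnedTransfer)
open Summit.BirchSwinnertonDyer.BirchSwinnertonDyer.Cruxes.BeyondCarrierDepthX10b.UpperHalf
  (upperLink_of_imcWaldspurgerOnTreeGoodAt)

namespace Summit.BirchSwinnertonDyer.BirchSwinnertonDyer.Cruxes.BeyondCarrierDepthX10b.HowardFrames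

/-- **v6.2 stub s2b BY SIGNATURE modulo the cite-only fact `hCGLS`** (CGLS 2022 Thm. 4.1.3 localized, any class
number): on a rank-one `3 ∣ h_K` X10b Heegner frame, for every `(D, C, X)`, the modules `𝔖 = D.S` and `X.X` are
finitely generated over `Λ` and `(p^m)·I(Λκ_∞(C))² ⊆ char_Λ(X_tors)` for some `m`.
[cite: CastellaGrossiLeeSkinner2022, Thm. 4.1.3 with Cor. 3.4.2 and Rem. 4.1.4 (arXiv:2008.02571)] [cite: GreenbergLNM1716, §1] -/
theorem stub_localizedStabilized_divisibleClassNumber_of_cgls'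
    (hCGLS : thm413_rankOne_charIdeal_torsion_dvd_localized.{0}) :
    ∀ (W : WeierstrassCurve ℚ) [W.IsElliptic] [W.IsGloballyMinimal] (p : ℕ) [Fact p.Prime]
    [NeZero (W.conductorNorm ℤ)] (K : Type) [Field K] [NumberField K],
    Literature.NumberTheory.EllipticCurves.Rank1Residual.ClassX10 W p →
    ¬ Literature.NumberTheory.EllipticCurves.Rank1Residual.Surj W 3 → ¬ W.HasCM →
    Literature.NumberTheory.EllipticCurves.IsImaginaryQuadratic K → Odd (NumberField.discr K) →
    NumberField.discr K ≠ -3 →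
    Literature.NumberTheory.EllipticCurves.SatisfiesHeegnerHypothesis (W.conductorNorm ℤ) K →
    Literature.NumberTheory.EllipticCurves.SatisfiesHeegnerHypothesis p K →
    p ∣ NumberField.classNumber K →
    (W.baseChange K).HasIrreducibleModPGaloisRep p →
    ∀ (κ : Literature.NumberTheory.EllipticCurves.ZpExtension K p), κ.IsAnticyclotomic →
    ∀ (γ : Field.absoluteGaloisGroup K), κ.IsTopGenerator γ →
    ∀ (jbar : AlgebraicClosure K →+* ℂ),
    (W.baseChange K).mordellWeilRank = 1 →
    Finite (AddCommGroup.primaryComponent (W.baseChange K).sha p) →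
    ∀ (D : (W.baseChange K).LambdaAdicSelmerData κ γ)
      (C : Literature.NumberTheory.EllipticCurves.CastellaGrossiLeeSkinner2022.StabilizedHeegnerData
        (W.conductorNorm ℤ) W K κ jbar)
      (X : (W.baseChange K).SelmerDualData κ γ),
    Module.Finite (Literature.NumberTheory.EllipticCurves.IwasawaAlgebra p) D.S ∧
    Module.Finite (Literature.NumberTheory.EllipticCurves.IwasawaAlgebra p) X.X ∧
    ∃ m : ℕ, Ideal.span {((p : Literature.NumberTheory.EllipticCurves.IwasawaAlgebra p) ^ m)} *
          Literature.NumberTheory.EllipticCurves.CastellaGrossiLeeSkinner2022.stabilizedHeegnerCharIdeal D C ^ 2 ≤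
        Literature.NumberTheory.EllipticCurves.Module.charIdeal
          (Literature.NumberTheory.EllipticCurves.IwasawaAlgebra p)
          (Submodule.torsion (Literature.NumberTheory.EllipticCurves.IwasawaAlgebra p) X.X) := by
  intro W _ _ p _ _ K _ _ hX _ _ hK hodd h3 hHN hHp _ _ κ hκ γ hγ jbar hrk hfin D C X
  have hyp := X10.thm413Hypotheses_of_classX10 hX hK h3 hHN hHp hodd hκ hγ
  obtain ⟨⟨hfinS, -⟩, hfinX, -⟩ := hCGLS (W.conductorNorm ℤ) W K p κ γ jbar hyp D C X
  obtain ⟨m, hm⟩ := span_pow_mul_sq_le_charIdeal_torsion_of_thm413 hCGLS hyp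
    (X9.selmerCorank_eq_one_of_rank_one hrk hfin) D C X
  exact ⟨hfinS, hfinX, m, hm⟩

/-- **v6.2 stub s2c (the μ-part) BY SIGNATURE from the μ-INEQUALITY** — the HPMC-implied residual of the crux in
the kernel's letter: if on every rank-one `3 ∣ h_K` X10b Heegner frame, for every `Λ`-adic Selmer datum `D`, every
Heegner family `F` TIED to the frame (`F.Dt = Dt`) and every Selmer dual `X` with `𝔖`, `X.X` finitely generated and
`𝔖/ℋ_F` torsion, the local lengths at `(p)` satisfy `length (X_tors)_(p) ≤ 2 · length (𝔖/ℋ_F)_(p)`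
(`μ(X_tors) ≤ 2 μ(𝔖/ℋ_F)`), then s2c holds: `(p^m)·I(ℋ_F)² ⊆ char_Λ(X_tors)` promotes to `I(ℋ_F)² ⊆ char_Λ(X_tors)`
by `IwasawaAlgebra.sq_charIdeal_le_charIdeal_of_span_p_pow_mul_le_of_lengthAt_le_two_mul` (p613811), since `I(ℋ_F)`
is `char_Λ(𝔖/ℋ_F)` by definition. NOT in print at `p = 3`, `3 ∣ h_K`, (irr) ¬Surj (it is the μ-part of Howard's
divisibility / of Perrin-Riou's Conjecture B). [cite: PerrinRiou1987BSMF, §1 Conj. B] [cite: Washington1997, §13.2]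
[cite: Howard2004HeegnerKolyvagin, Thm. B] [cite: CastellaGrossiLeeSkinner2022, Cor. 3.4.2] -/
theorem stub_muPart_divisibleClassNumber_of_muInvariant_le
    (hμle : ∀ (W : WeierstrassCurve ℚ) [W.IsElliptic] [W.IsGloballyMinimal] (p : ℕ) [Fact p.Prime]
      [NeZero (W.conductorNorm ℤ)] (K : Type) [Field K] [NumberField K],
      Literature.NumberTheory.EllipticCurves.Rank1Residual.ClassX10 W p →
      ¬ Literature.NumberTheory.EllipticCurves.Rank1Residual.Surj W 3 → ¬ W.HasCM →
      Literature.NumberTheory.EllipticCurves.IsImaginaryQuadratic K → Odd (NumberField.discr K) →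
      NumberField.discr K ≠ -3 →
      Literature.NumberTheory.EllipticCurves.SatisfiesHeegnerHypothesis (W.conductorNorm ℤ) K →
      Literature.NumberTheory.EllipticCurves.SatisfiesHeegnerHypothesis p K →
      p ∣ NumberField.classNumber K →
      (W.baseChange K).HasIrreducibleModPGaloisRep p →
      ∀ (κ : Literature.NumberTheory.EllipticCurves.ZpExtension K p), κ.IsAnticyclotomic →
      ∀ (γ : Field.absoluteGaloisGroup K), κ.IsTopGenerator γ →
      ∀ (Dt : Literature.NumberTheory.EllipticCurves.ModularForms.ModularParametrizationData W
        (W.conductorNorm ℤ)) (jbar : AlgebraicClosure K →+* ℂ),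
      ¬ (p : ℤ) ∣ Dt.c → (W.baseChange K).mordellWeilRank = 1 →
      Finite (AddCommGroup.primaryComponent (W.baseChange K).sha p) →
      ∀ (D : (W.baseChange K).LambdaAdicSelmerData κ γ)
        (F : Literature.NumberTheory.EllipticCurves.HeegnerFamily (W.conductorNorm ℤ) W K κ jbar)
        (X : (W.baseChange K).SelmerDualData κ γ), F.Dt = Dt →
        Module.Finite (Literature.NumberTheory.EllipticCurves.IwasawaAlgebra p) D.S →
        Module.Finite (Literature.NumberTheory.EllipticCurves.IwasawaAlgebra p) X.X →
        Module.IsTorsion (Literature.NumberTheory.EllipticCurves.IwasawaAlgebra p)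
          (D.S ⧸ Literature.NumberTheory.EllipticCurves.heegnerModule D F) →
      ∀ 𝔭 : PrimeSpectrum (Literature.NumberTheory.EllipticCurves.IwasawaAlgebra p),
        𝔭.asIdeal = Ideal.span {(p : Literature.NumberTheory.EllipticCurves.IwasawaAlgebra p)} →
        Module.lengthAt (Literature.NumberTheory.EllipticCurves.IwasawaAlgebra p)
          (Submodule.torsion (Literature.NumberTheory.EllipticCurves.IwasawaAlgebra p) X.X) 𝔭 ≤
        2 * Module.lengthAt (Literature.NumberTheory.EllipticCurves.IwasawaAlgebra p)
          (D.S ⧸ Literature.NumberTheory.EllipticCurves.heegnerModule D F) 𝔭) :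
    ∀ (W : WeierstrassCurve ℚ) [W.IsElliptic] [W.IsGloballyMinimal] (p : ℕ) [Fact p.Prime]
    [NeZero (W.conductorNorm ℤ)] (K : Type) [Field K] [NumberField K],
    Literature.NumberTheory.EllipticCurves.Rank1Residual.ClassX10 W p →
    ¬ Literature.NumberTheory.EllipticCurves.Rank1Residual.Surj W 3 → ¬ W.HasCM →
    Literature.NumberTheory.EllipticCurves.IsImaginaryQuadratic K → Odd (NumberField.discr K) →
    NumberField.discr K ≠ -3 →
    Literature.NumberTheory.EllipticCurves.SatisfiesHeegnerHypothesis (W.conductorNorm ℤ) K →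
    Literature.NumberTheory.EllipticCurves.SatisfiesHeegnerHypothesis p K →
    p ∣ NumberField.classNumber K →
    (W.baseChange K).HasIrreducibleModPGaloisRep p →
    ∀ (κ : Literature.NumberTheory.EllipticCurves.ZpExtension K p), κ.IsAnticyclotomic →
    ∀ (γ : Field.absoluteGaloisGroup K), κ.IsTopGenerator γ →
    ∀ (Dt : Literature.NumberTheory.EllipticCurves.ModularForms.ModularParametrizationData W
      (W.conductorNorm ℤ))
      (H : Literature.NumberTheory.EllipticCurves.HeegnerDatum (W.conductorNorm ℤ) (NumberField.discr K))
      (ιC : K →+* ℂ) (jbar : AlgebraicClosure K →+* ℂ),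
    ¬ (p : ℤ) ∣ Dt.c → (W.baseChange K).mordellWeilRank = 1 →
    Finite (AddCommGroup.primaryComponent (W.baseChange K).sha p) →
    (∃ (D : (W.baseChange K).LambdaAdicSelmerData κ γ)
        (F : Literature.NumberTheory.EllipticCurves.HeegnerFamily (W.conductorNorm ℤ) W K κ jbar)
        (X : (W.baseChange K).SelmerDualData κ γ) (m : ℕ),
        F.Dt = Dt ∧ Module.Finite (Literature.NumberTheory.EllipticCurves.IwasawaAlgebra p) D.S ∧
        Module.Finite (Literature.NumberTheory.EllipticCurves.IwasawaAlgebra p) X.X ∧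
        Module.IsTorsion (Literature.NumberTheory.EllipticCurves.IwasawaAlgebra p)
          (D.S ⧸ Literature.NumberTheory.EllipticCurves.heegnerModule D F) ∧
        Ideal.span {((p : Literature.NumberTheory.EllipticCurves.IwasawaAlgebra p) ^ m)} *
            Literature.NumberTheory.EllipticCurves.heegnerCharIdeal D F ^ 2 ≤
          Literature.NumberTheory.EllipticCurves.Module.charIdeal
            (Literature.NumberTheory.EllipticCurves.IwasawaAlgebra p)
            (Submodule.torsion (Literature.NumberTheory.EllipticCurves.IwasawaAlgebra p) X.X)) →
    ∃ (D : (W.baseChange K).LambdaAdicSelmerData κ γ)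
      (F : Literature.NumberTheory.EllipticCurves.HeegnerFamily (W.conductorNorm ℤ) W K κ jbar)
      (X : (W.baseChange K).SelmerDualData κ γ),
      F.Dt = Dt ∧ Literature.NumberTheory.EllipticCurves.heegnerCharIdeal D F ^ 2 ≤
        Literature.NumberTheory.EllipticCurves.Module.charIdeal
          (Literature.NumberTheory.EllipticCurves.IwasawaAlgebra p)
          (Submodule.torsion (Literature.NumberTheory.EllipticCurves.IwasawaAlgebra p) X.X) := by
  intro W _ _ p _ _ K _ _ hX hns hcm hK hodd h3 hHN hHp hhK hirr κ hκ γ hγ Dt H ιC jbar hc hrk hfin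
    ⟨D, F, X, m, hFDt, hfinS, hfinX, htors, hloc⟩
  haveI := hfinX
  haveI := hfinS
  haveI : IsNoetherian (IwasawaAlgebra p) X.X := isNoetherian_of_isNoetherianRing_of_finite _ _
  haveI : Module.Finite (IwasawaAlgebra p) (Submodule.torsion (IwasawaAlgebra p) X.X) := inferInstance
  haveI : Module.Finite (IwasawaAlgebra p) (D.S ⧸ heegnerModule D F) := inferInstance
  refine ⟨D, F, X, hFDt, ?_⟩
  exact IwasawaAlgebra.sq_charIdeal_le_charIdeal_of_span_p_pow_mul_le_of_lengthAt_le_two_mul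
    (Submodule.torsion_isTorsion (R := IwasawaAlgebra p) (M := X.X)) htors
    (hμle W p K hX hns hcm hK hodd h3 hHN hHp hhK hirr κ hκ γ hγ Dt jbar hc hrk hfin D F X hFDt hfinS hfinX htors)
    hloc

end Summit.BirchSwinnertonDyer.BirchSwinnertonDyer.Cruxes.BeyondCarrierDepthX10b.HowardFrames

end
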